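import Summits.Ventures.Crystal3D.Theses.StickyWulffConstant
import Summits.Ventures.Crystal3D.Theorems.StickyWulffConstantStackingLiminfUniformBound
import Summits.Ventures.Crystal3D.StickySpheres.FinsetBridge
import HarnessLib

/-!
# `StackingLiminf` for the fcc word, modulo Cicalese–Kreutz–Leonardi 2023; and the `∛243` rung
# in the finite-set vocabulary

Route `StickyWulffConstant` of the venture `Summits/Ventures/Crystal3D` (cell `crystal3d-full`),
support toward the crux `StackingLiminf` (item stmt-Ventures-19145).

1. CONDITIONAL (trust base: the Literature named fact
   `CicaleseKreutzLeonardi2023_surfaceConstants`, CKL 2023 Thm 2.3 + (25)): the statement of the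
   birth skeleton's stub `stub_fccLatticeLiminf` (HOME cf-p1/route/bc/StackingLiminf_line.lean) —
   the fcc-lattice surface liminf at `∛432 = 6·2^{1/3}` over injective `Fin N`-configurations —
   follows from the named fact through the dictionary of `StickySpheres/FinsetBridge.lean`
   (`fccLatticeLiminf_of_CKL`); equivalently the crux `StackingLiminf` restricted to the constant
   Hägg word (`stackingLiminf_constHagg_of_CKL`).  This is bookkeeping: the fact is NOT discharged.
2. UNCONDITIONAL: the word-uniform rung of `StickyWulffConstantStackingLiminfUniformBound.lean`
   read in the Literature's finite-set vocabulary: for every Hägg word `σ` and every finite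
   `X ⊆ barlowStacking 1 √(2/3) σ`, `∛243·|X|^{2/3} − 1 ≤ contactDeficiency X`
   (`cbrt243_rpow_le_contactDeficiency_of_subset_barlow`), hence the lower-bound clause of
   `HasSurfaceConstant (barlowStacking 1 √(2/3) σ) γ` for every `γ ≤ ∛243 = 6.2403…`, with `N₀`
   independent of `σ` (`barlow_surfaceLowerBound_of_le_cbrt243`; the tree had `γ ≤ 6` for fcc only,
   `fcc_surfaceLowerBound_of_le_six`).

WHAT THIS IS NOT: a proof of `StackingLiminf` (constant `∛432`, all words); no discharge of the
CKL fact; nothing off-lattice.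
-/

noncomputable section

namespace Summit.Ventures.Crystal3D.Theorems

open Finset
open Literature.MathematicalPhysics.StatisticalMechanics (fccStacking barlowStacking constHagg
  IsHaggSeq isHaggSeq_const contactDeficiency gammaFcc CicaleseKreutzLeonardi2023_surfaceConstants)

/-! ## 1. The fcc word, modulo the CKL named fact -/

/-- **The fcc-lattice surface liminf at `∛432`, CONDITIONAL on Cicalese–Kreutz–Leonardi 2023**
(the statement of the skeleton stub `stub_fccLatticeLiminf` of crux `StackingLiminf`): assuming
`CicaleseKreutzLeonardi2023_surfaceConstants`, for every `ε > 0` there is `N₀` such that every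
injective `y : Fin N → ℝ³` (`N ≥ N₀`) with all points on `fccStacking 1 √(2/3)` has
`(6·2^{1/3} − ε) N^{2/3} ≤ 6N − numContacts y`. -/
theorem fccLatticeLiminf_of_CKL (h : CicaleseKreutzLeonardi2023_surfaceConstants) :
    ∀ ε : ℝ, 0 < ε → ∃ N₀ : ℕ, ∀ N : ℕ, N₀ ≤ N →
      ∀ y : Fin N → EuclideanSpace ℝ (Fin 3), Function.Injective y →
        (∀ i, y i ∈ fccStacking 1 (Real.sqrt (2 / 3))) →
          ((6 * (2 : ℝ) ^ ((1 : ℝ) / 3)) - ε) * (N : ℝ) ^ ((2 : ℝ) / 3) ≤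
            6 * (N : ℝ) - (numContacts y : ℝ) := by
  classical
  intro ε hε
  obtain ⟨N₀, hN₀⟩ := h.1.1 ε hε
  refine ⟨N₀, fun N hN y hy hmem => ?_⟩
  have hsub : (↑(univ.image y) : Set (EuclideanSpace ℝ (Fin 3))) ⊆
      fccStacking 1 (Real.sqrt (2 / 3)) := by
    intro p hp
    rw [mem_coe, mem_image] at hp
    obtain ⟨i, -, rfl⟩ := hp
    exact hmem i
  have key := hN₀ N hN (univ.image y) hsub (card_image_univ_eq y hy)
  rw [contactDeficiency_image_eq y hy] at key
  unfold gammaFcc at key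
  exact key

/-- **`StackingLiminf` restricted to the fcc word `constHagg`, CONDITIONAL on CKL 2023**: the
crux's inequality `(6·2^{1/3} − ε) N^{2/3} ≤ 6N − numContacts x` for injective configurations on
`barlowStacking 1 √(2/3) constHagg = fccStacking 1 √(2/3)`. -/
theorem stackingLiminf_constHagg_of_CKL (h : CicaleseKreutzLeonardi2023_surfaceConstants) :
    ∀ ε : ℝ, 0 < ε → ∃ N₀ : ℕ, ∀ N : ℕ, N₀ ≤ N →
      ∀ x : Fin N → EuclideanSpace ℝ (Fin 3), Function.Injective x →
        (∀ i, x i ∈ barlowStacking 1 (Real.sqrt (2 / 3)) constHagg) →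
          ((6 * (2 : ℝ) ^ ((1 : ℝ) / 3)) - ε) * (N : ℝ) ^ ((2 : ℝ) / 3) ≤
            6 * (N : ℝ) - (numContacts x : ℝ) :=
  fccLatticeLiminf_of_CKL h

/-! ## 2. The unconditional `∛243` rung in the finite-set vocabulary -/

/-- **`∛243·|X|^{2/3} − 1 ≤ contactDeficiency X` for every finite subset `X` of ANY Barlow
stacking** `barlowStacking 1 √(2/3) σ` (`σ` a Hägg sequence): the word-uniform rung
`numContacts_le_of_mem_barlowStacking_cbrt243` through the dictionary. -/
theorem cbrt243_rpow_le_contactDeficiency_of_subset_barlow (σ : ℤ → ℤ) (hσ : IsHaggSeq σ)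
    (X : Finset (EuclideanSpace ℝ (Fin 3)))
    (hX : (↑X : Set (EuclideanSpace ℝ (Fin 3))) ⊆ barlowStacking 1 (Real.sqrt (2 / 3)) σ) :
    (243 : ℝ) ^ ((1 : ℝ) / 3) * (X.card : ℝ) ^ ((2 : ℝ) / 3) - 1 ≤ contactDeficiency X := by
  classical
  set N := X.card with hN
  set x : Fin N → EuclideanSpace ℝ (Fin 3) := fun i => ((X.equivFin.symm i : X) : _) with hxdef
  have hxinj : Function.Injective x := fun i j h =>
    X.equivFin.symm.injective (Subtype.ext h)
  have hmem : ∀ i, x i ∈ barlowStacking 1 (Real.sqrt (2 / 3)) σ := fun i =>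
    hX (mem_coe.2 (X.equivFin.symm i).2)
  have himage : univ.image x = X := by
    ext p
    simp only [mem_image, mem_univ, true_and]
    constructor
    · rintro ⟨i, rfl⟩
      exact (X.equivFin.symm i).2
    · intro hp
      exact ⟨X.equivFin ⟨p, hp⟩, by simp [hxdef]⟩
  have hC := numContacts_le_of_mem_barlowStacking_cbrt243 σ hσ x hxinj hmem
  rw [← himage, contactDeficiency_image_eq x hxinj]
  linarith

/-- **The lower-bound clause of `HasSurfaceConstant (barlowStacking 1 √(2/3) σ) γ` for every
`γ ≤ ∛243 = 6.2403…` and every Hägg word `σ`, unconditionally** (with `N₀` depending on `ε` only,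
not on `σ`): eventually every `N`-subset has `contactDeficiency ≥ (γ − ε) N^{2/3}`. -/
theorem barlow_surfaceLowerBound_of_le_cbrt243 {γ : ℝ} (hγ : γ ≤ (243 : ℝ) ^ ((1 : ℝ) / 3)) :
    ∀ ε : ℝ, 0 < ε → ∃ N₀ : ℕ, ∀ N : ℕ, N₀ ≤ N → ∀ σ : ℤ → ℤ, IsHaggSeq σ →
      ∀ X : Finset (EuclideanSpace ℝ (Fin 3)),
        (↑X : Set (EuclideanSpace ℝ (Fin 3))) ⊆ barlowStacking 1 (Real.sqrt (2 / 3)) σ →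
          X.card = N → (γ - ε) * (N : ℝ) ^ ((2 : ℝ) / 3) ≤ contactDeficiency X := by
  intro ε hε
  obtain ⟨N₀, hN₀⟩ := exists_nat_ge ((1 / ε) ^ ((3 : ℝ) / 2))
  refine ⟨N₀, fun N hN σ hσ X hX hcard => ?_⟩
  have h := cbrt243_rpow_le_contactDeficiency_of_subset_barlow σ hσ X hX
  rw [hcard] at h
  have hNr : (1 / ε) ^ ((3 : ℝ) / 2) ≤ (N : ℝ) := hN₀.trans (by exact_mod_cast hN)
  have hpow : 1 / ε ≤ (N : ℝ) ^ ((2 : ℝ) / 3) := by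
    have h := Real.rpow_le_rpow (by positivity) hNr (by norm_num : (0 : ℝ) ≤ (2 : ℝ) / 3)
    rwa [← Real.rpow_mul (by positivity), show ((3 : ℝ) / 2) * ((2 : ℝ) / 3) = 1 by norm_num,
      Real.rpow_one] at h
  have hone : 1 ≤ ε * (N : ℝ) ^ ((2 : ℝ) / 3) := by
    have := mul_le_mul_of_nonneg_left hpow hε.le
    rwa [mul_one_div_cancel hε.ne'] at this
  have hP : (0 : ℝ) ≤ (N : ℝ) ^ ((2 : ℝ) / 3) := by positivity
  nlinarith [mul_le_mul_of_nonneg_right hγ hP]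

end Summit.Ventures.Crystal3D.Theorems

end
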